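import Summits.Ventures.HSemireg.WedgeHankelSiegelIdealKernel

/-!
# Venture HSemireg — THE SIEGEL IDEAL (4/3, stabilisation): `⋂_q ker(θ ↦ θ ∧ w_n(q) ∣ ⋀^k) = SI_k` in EVERY degree `k`, also beyond the middle
# (`2k > n`), by embedding the first `n` pairs into `N = n + 2k` pairs; the `n + 1` powers `E_p = Θ^p/p!` as a finite test family

HONEST FRAMING. Part of the Lean index of the computation cell `pub-hsemireg` (seat p10 gen 11, Sunday typer «UNIFORM-IN-n»).
Finite-dimensional EXTERIOR ALGEBRA over a field (plus polynomials in one central variable) ONLY; no variety, no cohomology theory, no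
sheaf, no Ext group, no semiregularity map; nothing here says that HC / HC_CM / HC_AV holds; no Literature fact is declared or used.
Custodian versions as in `WedgeHankelSiegelIdeal` (1/3): FORMULA-N PART A §2.6 THEOREM H / FN-4 (i) «with v-independent kernel the Θ-isotropic
part»; the dictionary (`⌟v` on `HT^k` ↦ `θ ↦ θ ∧ w_n(q)` on `⋀^k K^{2n}`; the embedding = an abelian `n`-fold as a factor of an `N`-fold, same `Θ`
on the first `n` coordinate pairs) is QUOTED, never asserted.

WHY.  (3/3) proved `⋂_q ker(θ ↦ θ ∧ w_n(q) ∣ ⋀^k) = SI_k` for `2k ≤ n` only, because there a SINGLE class (`E_k = Θ^k/k!`, full row rank of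
`H_k(δ_k)`) already has kernel `SI_k`; for `2k > n` every Hankel matrix `H_k(q)` (`k+1` rows, `n+1−k < k+1` columns) has row-corank `≥ 2k − n`,
so by the EXCESS LAW every single class has kernel strictly bigger than `SI_k`, and only the whole family cuts it down.  THIS FILE (continues
namespace `Summit.Ventures.HSemireg.Wedge.HankelSiegelIdeal`; imports (3/3)) removes the hypothesis by STABILISATION in `n`:
* §7 `ext2` / `emb2 : ⋀(K^{2n}) →ₐ ⋀(K^{2N})` (the first `n` pairs; `ExteriorAlgebra.map` of the extension by zero), `emb2_X` / `emb2_Y`,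
  **`emb2_w`: `emb2 (w_m(q)) = w_m(q)` for `m ≤ n ≤ N`** (th-7's recursion only uses the first `m` pairs); **`w_mem_wSpan`: UNROLLING the
  recursion, `w_m(q) ∈ Σ_{q'} w_n(q') ∧ ⋀(K^{2N})` for `n ≤ m`**, hence **`emb2_mul_w_eq_zero`: a form on the first `n` pairs killed by every
  `w_n(q')` is killed by every `w_N(q)`**; `emb2_mem_exteriorPower` (degrees are kept, via `ιMulti`); `ext1` / `emb1 : ⋀(K^n) →ₐ ⋀(K^N)` on the
  `u`-variables, **`sym_comp_emb2`: `sym_N ∘ emb2 = (map emb1) ∘ sym_n`** (algebra maps agreeing on generators), `emb1_injective`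
  (`ExteriorAlgebra.map_injective_field`), hence **`sym_eq_zero_of_sym_emb2`: `sym_N (emb2 θ) = 0 ⇒ sym_n θ = 0`**.
* **THE COMMON KERNEL IN EVERY DEGREE — `mem_siegelIdeal_of_forall_mul_w` / `mem_siegelIdeal_iff_forall_mul_w'` / `iInf_ker_wedge_w_eq_siegelIdeal'`:
  for EVERY field, `n`, `k`: a `k`-form `θ` lies in `SI_k` iff `θ ∧ w_n(q) = 0` for every class `q`** (embed into `N = n + 2k` pairs, where
  (3/3)'s single-class statement applies, read off `sym_N (emb2 θ) = 0`, come back to `sym_n θ = 0`, and use (3/3)'s `SI_k = ker(sym ∣ ⋀^k)`).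
* §8 LINEARITY IN THE CLASS: `w_eq_sum_spikes`: `w_n(q) = Σ_{p ≤ n} q_p · w_n(δ_p)` (closed form `G_top`), so **`mem_siegelIdeal_iff_forall_spike`:
  `θ ∈ SI_k ⟺ θ ∧ E_p = 0` for the `n + 1` classes `E_p = w_n(δ_p)` (`Θ^p/p!`), `p ≤ n`** — a finite test family in every degree.
In the quoted dictionary: the «Θ-isotropic part» of `HT^k` — what NO polynomial in `Θ` can see — is the Siegel ideal, in every degree, named and
counted (`dim = C(2n,k) − (k+1)·C(n,k)`), and the powers of the polarisation alone decide membership.  NOT typed: a test family SMALLER than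
`{E_0, …, E_n}` beyond the middle (for `2k ≤ n` the single class `E_k` suffices, (3/3)); boxes of several factors; anything Ext-side.  Class side only.
-/

open Module

namespace Summit.Ventures.HSemireg.Wedge.HankelSiegelIdeal

open Summit.Ventures.HSemireg.Wedge Summit.Ventures.HSemireg.Wedge.Hankel
  Summit.Ventures.HSemireg.Wedge.HankelSiegel

variable (K : Type*) [Field K] {n : ℕ}

/-! ## §7. Stabilisation `n ↦ N`: the common kernel is the Siegel ideal in EVERY degree (also `2k > n`) -/

section Stable

variable (n N : ℕ)

/-- extension by zero of coefficient vectors along the first `n` pairs of `In N`: `x_a ↦ x_a`, `y_a ↦ y_a` (`a < n`). -/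
def ext2 : (In n → K) →ₗ[K] (In N → K) where
  toFun v j := if h : (j : ℕ) < n then v ⟨j, by omega⟩
    else if h' : N ≤ (j : ℕ) ∧ (j : ℕ) < N + n then v ⟨(j : ℕ) - N + n, by omega⟩ else 0
  map_add' v v' := by
    funext j
    simp only [Pi.add_apply]
    split_ifs <;> simp
  map_smul' c v := by
    funext j
    simp only [Pi.smul_apply, smul_eq_mul, RingHom.id_apply]
    split_ifs <;> simp

/-- extension by zero `K^n → K^N` along the first `n` coordinates (the `u`-variables). -/
def ext1 : (Fin n → K) →ₗ[K] (Fin N → K) where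
  toFun v c := if h : (c : ℕ) < n then v ⟨c, h⟩ else 0
  map_add' v v' := by
    funext c
    simp only [Pi.add_apply]
    split_ifs <;> simp
  map_smul' a v := by
    funext c
    simp only [Pi.smul_apply, smul_eq_mul, RingHom.id_apply]
    split_ifs <;> simp

/-- the induced algebra map `⋀(K^{2n}) → ⋀(K^{2N})` (first `n` pairs). -/
noncomputable def emb2 : HT K (In n) →ₐ[K] HT K (In N) := ExteriorAlgebra.map (ext2 K n N)

/-- the induced algebra map `⋀(K^n) → ⋀(K^N)` on the `u`-variables. -/
noncomputable def emb1 : HT K (Fin n) →ₐ[K] HT K (Fin N) := ExteriorAlgebra.map (ext1 K n N)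

variable {n N}

/-- `ext2 (e_{x_a}) = e_{x_a}`. -/
lemma ext2_b_castAdd (hn : n ≤ N) (a : Fin n) :
    ext2 K n N (b K (In n) (Fin.castAdd n a)) = b K (In N) (Fin.castAdd N (Fin.castLE hn a)) := by
  funext j
  simp only [ext2, LinearMap.coe_mk, AddHom.coe_mk, b, Pi.basisFun_apply, Pi.single_apply, Fin.ext_iff, Fin.val_castAdd,
    Fin.val_castLE]
  split_ifs <;> first | rfl | omega

/-- `ext2 (e_{y_a}) = e_{y_a}`. -/
lemma ext2_b_natAdd (hn : n ≤ N) (a : Fin n) :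
    ext2 K n N (b K (In n) (Fin.natAdd n a)) = b K (In N) (Fin.natAdd N (Fin.castLE hn a)) := by
  funext j
  simp only [ext2, LinearMap.coe_mk, AddHom.coe_mk, b, Pi.basisFun_apply, Pi.single_apply, Fin.ext_iff, Fin.val_natAdd,
    Fin.val_castLE]
  split_ifs <;> first | rfl | omega

/-- `emb2 (X_a) = X_a` (`a < n ≤ N`). -/
lemma emb2_X (hn : n ≤ N) {a : ℕ} (ha : a < n) : emb2 K n N (X K n a) = X K N a := by
  have h1 : X K n a = X K n ((⟨a, ha⟩ : Fin n) : ℕ) := rfl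
  have h2 : X K N a = X K N ((Fin.castLE hn ⟨a, ha⟩ : Fin N) : ℕ) := rfl
  rw [h1, X_eq_gx, Hankel.gx_eq_ι, emb2, ExteriorAlgebra.map_apply_ι, ext2_b_castAdd K hn, ← Hankel.gx_eq_ι, ← X_eq_gx, ← h2]

/-- `emb2 (Y_a) = Y_a` (`a < n ≤ N`). -/
lemma emb2_Y (hn : n ≤ N) {a : ℕ} (ha : a < n) : emb2 K n N (Y K n a) = Y K N a := by
  have h1 : Y K n a = Y K n ((⟨a, ha⟩ : Fin n) : ℕ) := rfl
  have h2 : Y K N a = Y K N ((Fin.castLE hn ⟨a, ha⟩ : Fin N) : ℕ) := rfl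
  rw [h1, Y_eq_gx, Hankel.gx_eq_ι, emb2, ExteriorAlgebra.map_apply_ι, ext2_b_natAdd K hn, ← Hankel.gx_eq_ι, ← Y_eq_gx, ← h2]

/-- **`emb2 (w_m(q)) = w_m(q)` for `m ≤ n ≤ N`**: th-7's recursion uses only the first `m` pairs. -/
theorem emb2_w (hn : n ≤ N) {m : ℕ} (hm : m ≤ n) (q : ℕ → K) : emb2 K n N (w K n m q) = w K N m q := by
  induction m generalizing q with
  | zero => simp only [w, map_smul, map_one]
  | succ m ih =>
    rw [w, w, map_add, map_mul, map_mul, ih (by omega), ih (by omega), emb2_X K hn (by omega), emb2_Y K hn (by omega)]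

/-- the right ideal generated by the classes `w_n(q')` of the first `n` pairs inside `⋀(K^{2N})`. -/
noncomputable def wSpan (n N : ℕ) : Submodule K (HT K (In N)) :=
  Submodule.span K {x | ∃ (q' : ℕ → K) (z : HT K (In N)), x = w K N n q' * z}

/-- `wSpan` is closed under right multiplication. -/
lemma mul_mem_wSpan {x : HT K (In N)} (hx : x ∈ wSpan K n N) (y : HT K (In N)) : x * y ∈ wSpan K n N := by
  induction hx using Submodule.span_induction with
  | mem x hx =>
    obtain ⟨q', z, rfl⟩ := hx
    exact Submodule.subset_span ⟨q', z * y, by rw [mul_assoc]⟩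
  | zero => rw [zero_mul]; exact Submodule.zero_mem _
  | add x x' _ _ hx hx' => rw [add_mul]; exact Submodule.add_mem _ hx hx'
  | smul c x _ hx => rw [smul_mul_assoc]; exact Submodule.smul_mem _ _ hx

/-- **UNROLLING THE RECURSION: `w_m(q) ∈ Σ_{q'} w_n(q') ∧ ⋀(K^{2N})` for `n ≤ m`.** -/
theorem w_mem_wSpan {m : ℕ} (hm : n ≤ m) (q : ℕ → K) : w K N m q ∈ wSpan K n N := by
  induction m, hm using Nat.le_induction generalizing q with
  | base => exact Submodule.subset_span ⟨q, 1, by rw [mul_one]⟩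
  | succ m _ ih => rw [w]; exact Submodule.add_mem _ (mul_mem_wSpan K (ih q) _) (mul_mem_wSpan K (ih _) _)

/-- **a form on the first `n` pairs killed by every `w_n(q')` is killed by every `w_N(q)` (`n ≤ N`).** -/
theorem emb2_mul_w_eq_zero (hn : n ≤ N) {θ : HT K (In n)} (h : ∀ q : ℕ → K, θ * w K n n q = 0) (q : ℕ → K) :
    emb2 K n N θ * w K N N q = 0 := by
  have key : ∀ x ∈ wSpan K n N, emb2 K n N θ * x = 0 := by
    intro x hx
    induction hx using Submodule.span_induction with
    | mem x hx =>
      obtain ⟨q', z, rfl⟩ := hx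
      rw [← mul_assoc, ← emb2_w K hn le_rfl q', ← map_mul, h q', map_zero, zero_mul]
    | zero => rw [mul_zero]
    | add x x' _ _ hx hx' => rw [mul_add, hx, hx', add_zero]
    | smul c x _ hx => rw [mul_smul_comm, hx, smul_zero]
  exact key _ (w_mem_wSpan K hn q)

/-- `emb2` preserves the degree: `emb2 (⋀^k) ⊆ ⋀^k`. -/
lemma emb2_mem_exteriorPower {k : ℕ} {θ : HT K (In n)} (hθ : θ ∈ ⋀[K]^k (In n → K)) : emb2 K n N θ ∈ ⋀[K]^k (In N → K) := by
  rw [← ExteriorAlgebra.ιMulti_span_fixedDegree] at hθ ⊢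
  induction hθ using Submodule.span_induction with
  | mem x hx =>
    obtain ⟨v, rfl⟩ := hx
    rw [emb2, ExteriorAlgebra.map_apply_ιMulti]
    exact Submodule.subset_span ⟨_, rfl⟩
  | zero => rw [map_zero]; exact Submodule.zero_mem _
  | add x y _ _ hx hy => rw [map_add]; exact Submodule.add_mem _ hx hy
  | smul c x _ hx => rw [map_smul]; exact Submodule.smul_mem _ _ hx

/-- the `x`-halves commute with the extensions. -/
lemma xpart_ext2 (v : In n → K) : xpart K (ext2 K n N v) = ext1 K n N (xpart K v) := by
  funext c
  simp only [xpart, LinearMap.funLeft_apply, ext2, ext1, LinearMap.coe_mk, AddHom.coe_mk, Fin.val_castAdd]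
  split_ifs <;> first | rfl | (exfalso; omega)

/-- the `y`-halves commute with the extensions (`n ≤ N`). -/
lemma ypart_ext2 (hn : n ≤ N) (v : In n → K) : ypart K (ext2 K n N v) = ext1 K n N (ypart K v) := by
  funext c
  simp only [ypart, LinearMap.funLeft_apply, ext2, ext1, LinearMap.coe_mk, AddHom.coe_mk, Fin.val_natAdd]
  split_ifs <;> first | rfl | (exfalso; omega) | (congr 1; apply Fin.ext; simp only [Fin.val_natAdd]; omega)

/-- `emb1` on generators. -/
lemma emb1_ι (x : Fin n → K) : emb1 K n N (ExteriorAlgebra.ι K x) = ExteriorAlgebra.ι K (ext1 K n N x) :=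
  ExteriorAlgebra.map_apply_ι _ _

/-- `emb2` on generators. -/
lemma emb2_ι (v : In n → K) : emb2 K n N (ExteriorAlgebra.ι K v) = ExteriorAlgebra.ι K (ext2 K n N v) :=
  ExteriorAlgebra.map_apply_ι _ _

/-- **THE SYMMETRISATIONS COMMUTE WITH THE STABILISATION: `sym_N ∘ emb2 = (map emb1) ∘ sym_n`** (both are algebra maps; check on generators). -/
theorem sym_comp_emb2 (hn : n ≤ N) :
    (sym K (n := N)).comp (emb2 K n N) = (Polynomial.mapAlgHom (emb1 K n N)).comp (sym K (n := n)) := by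
  apply ExteriorAlgebra.hom_ext
  apply LinearMap.ext
  intro v
  change sym K (emb2 K n N (ExteriorAlgebra.ι K v)) = Polynomial.mapAlgHom (emb1 K n N) (sym K (ExteriorAlgebra.ι K v))
  rw [emb2_ι, sym_ι, sym_ι]
  simp only [symLin, LinearMap.coe_mk, AddHom.coe_mk, Polynomial.coe_mapAlgHom, Polynomial.map_add, Polynomial.map_monomial,
    RingHom.coe_coe, emb1_ι, xpart_ext2, ypart_ext2 K hn]

/-- `ext1` is injective for `n ≤ N` (restriction is a section). -/
lemma ker_ext1 (hn : n ≤ N) : LinearMap.ker (ext1 K n N) = ⊥ := by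
  rw [LinearMap.ker_eq_bot']
  intro v hv
  funext c
  have := congrFun hv (Fin.castLE hn c)
  simpa [ext1, Fin.val_castLE, c.2] using this

/-- `emb1` is injective for `n ≤ N`. -/
lemma emb1_injective (hn : n ≤ N) : Function.Injective (emb1 K n N) :=
  ExteriorAlgebra.map_injective_field (ker_ext1 K hn)

/-- **`sym_n θ = 0 ⟺ sym_N (emb2 θ) = 0`** (`n ≤ N`; `map emb1` is injective). -/
theorem sym_eq_zero_of_sym_emb2 (hn : n ≤ N) {θ : HT K (In n)} (h : sym K (emb2 K n N θ) = 0) : sym K θ = 0 := by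
  have h1 : (Polynomial.mapAlgHom (emb1 K n N)) (sym K θ) = 0 := by
    rw [← AlgHom.comp_apply, ← sym_comp_emb2 K hn, AlgHom.comp_apply, h]
  rw [Polynomial.coe_mapAlgHom, ← Polynomial.map_zero (emb1 K n N : HT K (Fin n) →+* HT K (Fin N))] at h1
  exact Polynomial.map_injective _ (emb1_injective K hn) h1

end Stable

/-- **THE COMMON KERNEL IN EVERY DEGREE: a `k`-form killed by EVERY class `w_n(q)` lies in the Siegel ideal `SI_k`** — for every field, `n`, `k`
(no `2k ≤ n`: stabilise to `N = n + 2k` pairs, where the single class `E_k` suffices, and come back along the symmetrisation). -/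
theorem mem_siegelIdeal_of_forall_mul_w {k : ℕ} {θ : HT K (In n)} (hθ : θ ∈ ⋀[K]^k (In n → K))
    (h : ∀ q : ℕ → K, θ * w K n n q = 0) : θ ∈ siegelIdeal K n k := by
  have hn : n ≤ n + (k + k) := Nat.le_add_right _ _
  have hθ' := emb2_mem_exteriorPower K (N := n + (k + k)) hθ
  have hmem : emb2 K n (n + (k + k)) θ ∈ siegelIdeal K (n + (k + k)) k :=
    (mem_siegelIdeal_iff_forall_mul_w K (by omega) hθ').mpr (emb2_mul_w_eq_zero K hn h)
  have hs : sym K θ = 0 := sym_eq_zero_of_sym_emb2 K hn (sym_eq_zero_of_mem_siegelIdeal K hmem)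
  have hker : (⟨θ, hθ⟩ : ⋀[K]^k (In n → K)) ∈ LinearMap.ker (symk K n k) := by
    rw [LinearMap.mem_ker, symk, LinearMap.comp_apply, Submodule.subtype_apply, AlgHom.toLinearMap_apply]; exact hs
  rw [ker_symk_eq_siegelIdeal] at hker
  exact hker

/-- **`θ ∈ SI_k ⟺ θ ∧ w_n(q) = 0` for every `q`** — every field, `n`, `k` (th-6's «v-independent kernel = the Θ-isotropic part» in EVERY degree). -/
theorem mem_siegelIdeal_iff_forall_mul_w' {k : ℕ} {θ : HT K (In n)} (hθ : θ ∈ ⋀[K]^k (In n → K)) :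
    θ ∈ siegelIdeal K n k ↔ ∀ q : ℕ → K, θ * w K n n q = 0 :=
  ⟨fun h q => mul_w_eq_zero_of_mem_siegelIdeal K h q, mem_siegelIdeal_of_forall_mul_w K hθ⟩

/-- **`⋂_q ker(θ ↦ θ ∧ w_n(q) ∣ ⋀^k) = SI_k` in EVERY degree `k`** (for `2k > n` no single class achieves it: each `H_k(q)` has row-corank `≥ 2k − n`). -/
theorem iInf_ker_wedge_w_eq_siegelIdeal' (k : ℕ) :
    (⨅ q : ℕ → K, LinearMap.ker (Hankel.wedge K n k (w K n n q))) = (siegelIdeal K n k).comap (⋀[K]^k (In n → K)).subtype := by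
  apply le_antisymm
  · intro θ hθ
    refine mem_siegelIdeal_of_forall_mul_w K θ.2 fun q => ?_
    have := (Submodule.mem_iInf _).mp hθ q
    rwa [LinearMap.mem_ker, Hankel.wedge, LinearMap.comp_apply, Submodule.subtype_apply, LinearMap.mulRight_apply] at this
  · exact le_iInf fun q => siegelIdeal_le_ker K k q

/-! ## §8. Linearity in the class: the `n + 1` powers `E_p = w_n(δ_p)` (`Θ^p/p!`, `p ≤ n`) detect the Siegel ideal -/

/-- th-7's class is LINEAR in the coefficient sequence: **`w_n(q) = Σ_{p ≤ n} q_p · w_n(δ_p)`** (closed form `G_top`). -/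
theorem w_eq_sum_spikes (q : ℕ → K) :
    w K n n q = ∑ p ∈ Finset.range (n + 1), q p • w K n n (fun j => if j = p then (1 : K) else 0) := by
  rw [w_eq_G, G_top]
  apply Finset.sum_congr rfl
  intro p hp
  congr 1
  rw [w_eq_G, G_top, Finset.sum_eq_single p]
  · rw [if_pos rfl, one_smul]
  · intro m _ hmp
    rw [if_neg hmp, zero_smul]
  · intro hp'
    exact absurd hp hp'

/-- hence `θ ∧ w_n(q) = Σ_p q_p · (θ ∧ E_p)`: **a form killed by the `n + 1` classes `E_0, …, E_n` is killed by every class.** -/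
theorem mul_w_eq_zero_of_forall_spike {θ : HT K (In n)}
    (h : ∀ p ≤ n, θ * w K n n (fun j => if j = p then (1 : K) else 0) = 0) (q : ℕ → K) : θ * w K n n q = 0 := by
  rw [w_eq_sum_spikes, Finset.mul_sum]
  apply Finset.sum_eq_zero
  intro p hp
  rw [mul_smul_comm, h p (by simpa [Finset.mem_range, Nat.lt_succ_iff] using hp), smul_zero]

/-- **THE POWERS OF THE POLARISATION DETECT THE SIEGEL IDEAL: `θ ∈ SI_k ⟺ θ ∧ E_p = 0` for every `p ≤ n`** (every field, `n`, `k`;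
`E_p = w_n(δ_p)`, in the quoted dictionary the class `Θ^p/p!`). -/
theorem mem_siegelIdeal_iff_forall_spike {k : ℕ} {θ : HT K (In n)} (hθ : θ ∈ ⋀[K]^k (In n → K)) :
    θ ∈ siegelIdeal K n k ↔ ∀ p ≤ n, θ * w K n n (fun j => if j = p then (1 : K) else 0) = 0 :=
  ⟨fun h _ _ => mul_w_eq_zero_of_mem_siegelIdeal K h _,
    fun h => mem_siegelIdeal_of_forall_mul_w K hθ (mul_w_eq_zero_of_forall_spike K h)⟩


end Summit.Ventures.HSemireg.Wedge.HankelSiegelIdeal
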